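import Mathlib.Analysis.Calculus.BumpFunction.InnerProduct
import Literature.Analysis.PDE.SymmetricHyperbolicExistence
import Literature.Analysis.PDE.TorusLinearSymmetricHyperbolicLift
import HarnessLib

/-!
# Linear symmetric hyperbolic systems on the flat torus, II: global smooth solutions by transfer
# from the whole space (topic `Analysis/PDE`)

Analysis/PDE support file (everything proved; no definitions, no named facts). Third brick of the
EXISTENCE MECHANISM of the classical local theory of quasilinear symmetrisable hyperbolic systems
on `𝕋^d` (Dafermos 2005, Thm 5.1.1: the linearised iteration (5.1.10) "employ[s] the classical
theory of symmetrizable linear hyperbolic systems"; Majda 1984, Ch. 2 §2.1, proof of Thm 2.1).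
The main result is **`exists_torus_linear_symmHyp_solution`**: for jointly smooth operator fields
`Aⱼ, B : ℝ × 𝕋ⁿ → (W →L[ℝ] W)`, `Aⱼ(t, x)` symmetric, `W` a finite-dimensional real inner
product space, and smooth data `U₀ : 𝕋ⁿ → W`, the linear symmetric hyperbolic system

  `∂ₜu = ∑ⱼ Aⱼ(t, x) ∂ⱼu + B(t, x) u`,  `u(0) = U₀`,

has a solution `u` jointly `C^∞` on all of `ℝ × 𝕋ⁿ` (Friedrichs 1954, Thm 4.1; on the torus:
Taylor, *PDE III*, Ch. 16, Prop. 1.4–1.5 and §1 for compact manifolds / periodic boundary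
conditions). The proof is a TRANSFER from the tree's whole-space theorem
`exists_smooth_solution` (`SymmetricHyperbolicExistence.lean`, `C_c^∞` data on `ℝⁿ`):

1. the periodic lifts of the coefficients are a regular admissible family
   (`isRegularSymmCoeffFamily_lift`, part I);
2. the periodic lift of the data is cut off by bump functions equal to `1` on the balls
   `B̄(0, m + 1)`, `m ∈ ℕ`, and `exists_smooth_solution` gives global smooth solutions `V_m` on
   `ℝ × ℝⁿ`;
3. by the domain of dependence (`symmHyp_eq_zero_of_data_zero_ball_abs`, part I, from
   `coneEnergy_eq_zero`) two such solutions agree wherever their data agree up to the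
   propagation margin: the `V_m` stabilise on every compact set (`V_m = V_{m'}` on
   `|t| ≤ T, ‖y‖ < m + 1 - c_T |t|`), and the lattice translates of `V_m` agree with `V_{m'}`
   likewise (the coefficients are periodic), so the pointwise limit `U = lim V_m` is a jointly
   smooth, spatially lattice-periodic global solution with `U(0) = U₀ ∘ proj`;
4. `U` descends to the torus (`Torus.descend`), and the torus derivatives of the descent are
   read off from those of `U` (`Torus.fderiv_lift`, `Torus.partialDeriv_eq_fderiv_apply`).

Uniqueness and energy bounds for this solution are in `TorusSymmetricHyperbolicEnergy.lean`
(`symmHyp_eq_zero_of_initial`, `symmHypEnergy_le_gronwallBound`, stated there with a general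
symmetriser `A₀`); the reduction of `A₀ ∂ₜu + ∑ Aⱼ ∂ⱼu + B u = F` to the present form is NOT in
this file.

## Mathlib / tree search

Tree: `exists_smooth_solution`, `IsRegularSymmCoeffFamily`, `foOp` (`Analysis/PDE`, Friedrichs
1954 on `ℝⁿ`); part I of this file; `Torus.descend`, `lift_descend_holds`, `latticeVec_single`,
`IsLatticePeriodic.add_latticeVec_holds`, `fderiv_lift`, `partialDeriv_eq_fderiv_apply`
(`FlatTorus(Proofs)`, `TorusCalculus`). Mathlib: `ContDiffBump` (`one_of_mem_closedBall`,
`hasCompactSupport`), `Filter.Tendsto.limUnder_eq`, `Filter.EventuallyEq.fderiv_eq`,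
`HasDerivAt.congr_of_eventuallyEq`, `contDiff_iff_contDiffAt`.

## References

* C. M. Dafermos, *Hyperbolic Conservation Laws in Continuum Physics*, 2nd ed., Springer 2005,
  Ch. V §5.1, proof of Thm 5.1.1. [`Dafermos2005`]
* K. O. Friedrichs, *Symmetric hyperbolic linear differential equations*, Comm. Pure Appl.
  Math. 7 (1954) 345–392, Thm 4.1, §6. [`Friedrichs1954`]
* M. E. Taylor, *Partial Differential Equations III*, 2nd ed., Springer 2011, Ch. 16 §1,
  Prop. 1.4–1.5. [`TaylorPDEIII2011`]
* R. Racke, *Lectures on Nonlinear Evolution Equations*, 2nd ed., 2015, Ch. 3 Thm 3.1.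
  [`Racke2015`]
-/

noncomputable section

open Set Function Filter Metric
open scoped ContDiff InnerProductSpace Topology

namespace Literature.Analysis.PDE

open Literature.Analysis.FunctionSpaces Literature.Analysis.FunctionSpaces.Torus

variable {n : ℕ}
variable {W : Type*} [NormedAddCommGroup W] [InnerProductSpace ℝ W]

/-! ## Solutions of the whole-space system: differences, translates, local uniqueness -/

section WholeSpace

/-- **Differences of classical solutions are classical solutions** (linearity of `𝒫`).
[folklore] -/
theorem hasDerivAt_foOp_sub {a : Fin n → ℝ → EuclideanSpace ℝ (Fin n) → (W →L[ℝ] W)}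
    {b : ℝ → EuclideanSpace ℝ (Fin n) → (W →L[ℝ] W)} {V V' : ℝ → EuclideanSpace ℝ (Fin n) → W}
    (hV : ∀ t, Differentiable ℝ (V t)) (hV' : ∀ t, Differentiable ℝ (V' t))
    (heq : ∀ t y, HasDerivAt (fun s => V s y) (foOp (fun j => a j t) (b t) (V t) y) t)
    (heq' : ∀ t y, HasDerivAt (fun s => V' s y) (foOp (fun j => a j t) (b t) (V' t) y) t)
    (t : ℝ) (y : EuclideanSpace ℝ (Fin n)) :
    HasDerivAt (fun s => V s y - V' s y)
      (foOp (fun j => a j t) (b t) (fun z => V t z - V' t z) y) t := by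
  rw [foOp_fun_sub (hV t) (hV' t)]
  exact (heq t y).sub (heq' t y)

/-- **Lattice translates of classical solutions are classical solutions** when the coefficients
are lattice periodic. [folklore] -/
theorem hasDerivAt_foOp_translate {a : Fin n → ℝ → EuclideanSpace ℝ (Fin n) → (W →L[ℝ] W)}
    {b : ℝ → EuclideanSpace ℝ (Fin n) → (W →L[ℝ] W)} {V : ℝ → EuclideanSpace ℝ (Fin n) → W}
    {e : EuclideanSpace ℝ (Fin n)} (hae : ∀ j t y, a j t (y + e) = a j t y)
    (hbe : ∀ t y, b t (y + e) = b t y)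
    (heq : ∀ t y, HasDerivAt (fun s => V s y) (foOp (fun j => a j t) (b t) (V t) y) t)
    (t : ℝ) (y : EuclideanSpace ℝ (Fin n)) :
    HasDerivAt (fun s => V s (y + e)) (foOp (fun j => a j t) (b t) (fun z => V t (z + e)) y) t := by
  have h := heq t (y + e)
  have hfo : foOp (fun j => a j t) (b t) (fun z => V t (z + e)) y =
      foOp (fun j => a j t) (b t) (V t) (y + e) := by
    simp only [foOp_apply, fderiv_comp_add_right, hae, hbe]
  rw [hfo]
  exact h

/-- **Local uniqueness with a propagation speed depending only on the horizon**: for a regular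
admissible family on `ℝ × ℝⁿ` and every horizon `T` there is `c ≥ 0` such that any two jointly
smooth global classical solutions whose data agree on a closed ball `B̄(x₁, R)` agree at `(t, y)`
whenever `|t| ≤ T` and `dist(y, x₁) < R - c|t|` (`symmHyp_eq_zero_of_data_zero_ball_abs` for
the difference, with the order-one coefficient bounds of the family on `[-T, T]`).
[cite: Racke2015, Ch. 3 Thm 3.1] -/
theorem exists_speed_eq_of_data_eq {A : Fin n → ℝ → EuclideanSpace ℝ (Fin n) → (W →L[ℝ] W)}
    {B : ℝ → EuclideanSpace ℝ (Fin n) → (W →L[ℝ] W)} (h : IsRegularSymmCoeffFamily A B) (T : ℝ) :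
    ∃ c, 0 ≤ c ∧ ∀ (V V' : ℝ → EuclideanSpace ℝ (Fin n) → W),
      ContDiff ℝ ∞ (fun p : ℝ × EuclideanSpace ℝ (Fin n) => V p.1 p.2) →
      ContDiff ℝ ∞ (fun p : ℝ × EuclideanSpace ℝ (Fin n) => V' p.1 p.2) →
      (∀ t y, HasDerivAt (fun s => V s y) (foOp (fun j => A j t) (B t) (V t) y) t) →
      (∀ t y, HasDerivAt (fun s => V' s y) (foOp (fun j => A j t) (B t) (V' t) y) t) →
      ∀ (x₁ : EuclideanSpace ℝ (Fin n)) (R : ℝ), (∀ y ∈ closedBall x₁ R, V 0 y = V' 0 y) →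
      ∀ t, |t| ≤ T → ∀ y, dist y x₁ < R - c * |t| → V t y = V' t y := by
  by_cases hT : 0 ≤ T
  swap
  · exact ⟨0, le_rfl, fun V V' _ _ _ _ x₁ R _ t ht => absurd ((abs_nonneg t).trans ht) hT⟩
  obtain ⟨M, hM⟩ := h.coeff T 0
  have hM0 : 0 ≤ M := (hM 0 ⟨by linarith, hT⟩).nonneg
  refine ⟨n * M, by positivity, fun V V' hV hV' heq heq' x₁ R h0 t ht y hy => ?_⟩
  have hVd : ∀ t, Differentiable ℝ (V t) := fun t =>
    (hV.comp (contDiff_prodMk_right t)).differentiable (by simp)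
  have hV'd : ∀ t, Differentiable ℝ (V' t) := fun t =>
    (hV'.comp (contDiff_prodMk_right t)).differentiable (by simp)
  have hsymm : ∀ j t y (v w : W), ⟪A j t y v, w⟫_ℝ = ⟪v, A j t y w⟫_ℝ := fun j t y v w => by
    obtain ⟨M', hM'⟩ := h.toIsSymmCoeffFamily.exists_coeff t 0
    exact hM'.symm j y v w
  have hD := symmHyp_eq_zero_of_data_zero_ball_abs (a := A) (b := B)
    (D := fun s z => V s z - V' s z) (T := T) (M := M)
    (fun j => (h.jointA j).of_le (by simp)) (h.jointB.of_le (by simp))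
    hsymm hM0
    (fun j s hs z => by simpa using (hM s hs).boundA j [] (by simp) z)
    (fun s hs z => by simpa using (hM s hs).boundB [] (by simp) z)
    (fun j s hs z => by
      have hb := (hM s hs).boundA j [j] (by simp) z
      simpa [cwd_singleton] using hb)
    ((hV.sub hV').of_le (by simp))
    (hasDerivAt_foOp_sub hVd hV'd heq heq') (x₁ := x₁) (R := R)
    (fun z hz => sub_eq_zero.2 (h0 z hz)) ht hy
  exact sub_eq_zero.1 hD

end WholeSpace

/-! ## The transfer theorem -/

section Transfer

variable [CompleteSpace W] [FiniteDimensional ℝ W]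

/-- **Global smooth solutions of linear symmetric hyperbolic systems on the flat torus**
(Friedrichs 1954, Thm 4.1; Taylor, *PDE III*, Ch. 16 §1, Prop. 1.4–1.5; the linear step of
Dafermos 2005, Thm 5.1.1 / Majda 1984, Thm 2.1). Let `Aⱼ, B : ℝ × 𝕋ⁿ → (W →L[ℝ] W)` be jointly
`C^∞` operator fields with every `Aⱼ(t, x)` symmetric, `W` a finite-dimensional real inner
product space, and let `U₀ : 𝕋ⁿ → W` be smooth. Then there is `u : ℝ × 𝕋ⁿ → W`, jointly `C^∞`,
with `u(0) = U₀` and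

  `∂ₜu(t, x) = ∑ⱼ Aⱼ(t, x) ∂ⱼu(t, x) + B(t, x) u(t, x)`  for all `(t, x) ∈ ℝ × 𝕋ⁿ`

(`Torus.timeDeriv`, `Torus.partialDeriv`). Proof by transfer from `exists_smooth_solution` on
`ℝ × ℝⁿ` with cut-off periodic data and the domain of dependence (module docstring).
[cite: Friedrichs1954, Thm 4.1; TaylorPDEIII2011, Ch. 16 Prop. 1.4–1.5] -/
theorem exists_torus_linear_symmHyp_solution
    {A : Fin n → ℝ → UnitAddTorus (Fin n) → (W →L[ℝ] W)}
    {B : ℝ → UnitAddTorus (Fin n) → (W →L[ℝ] W)} (hA : ∀ j, IsSmoothSpaceTimeOn univ (A j))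
    (hB : IsSmoothSpaceTimeOn univ B)
    (hsym : ∀ j t x (v w : W), ⟪A j t x v, w⟫_ℝ = ⟪v, A j t x w⟫_ℝ)
    {U₀ : UnitAddTorus (Fin n) → W} (hU₀ : IsSmooth U₀) :
    ∃ u : ℝ → UnitAddTorus (Fin n) → W, IsSmoothSpaceTimeOn univ u ∧ u 0 = U₀ ∧
      ∀ t x, timeDeriv u t x = ∑ j, A j t x (partialDeriv j (u t) x) + B t x (u t x) := by
  -- the lifted coefficients
  set Al : Fin n → ℝ → EuclideanSpace ℝ (Fin n) → (W →L[ℝ] W) := fun j t => lift (A j t)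
    with hAl_def
  set Bl : ℝ → EuclideanSpace ℝ (Fin n) → (W →L[ℝ] W) := fun t => lift (B t) with hBl_def
  have hreg : IsRegularSymmCoeffFamily Al Bl := isRegularSymmCoeffFamily_lift hA hB hsym
  have hAper : ∀ (j : Fin n) (t : ℝ) (y : EuclideanSpace ℝ (Fin n)) (k : Fin n → ℤ),
      Al j t (y + latticeVec k) = Al j t y := fun j t y k => by
    simp only [hAl_def, lift_apply, proj_add_latticeVec]
  have hBper : ∀ (t : ℝ) (y : EuclideanSpace ℝ (Fin n)) (k : Fin n → ℤ),
      Bl t (y + latticeVec k) = Bl t y := fun t y k => by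
    simp only [hBl_def, lift_apply, proj_add_latticeVec]
  -- the cut-off data
  have hU₀l : ContDiff ℝ ∞ (lift U₀) := hU₀
  let bump : ℕ → ContDiffBump (0 : EuclideanSpace ℝ (Fin n)) := fun m =>
    ⟨(m : ℝ) + 1, (m : ℝ) + 2, by positivity, by linarith⟩
  let data : ℕ → EuclideanSpace ℝ (Fin n) → W := fun m y => (bump m) y • lift U₀ y
  have hdata_smooth : ∀ m, ContDiff ℝ ∞ (data m) := fun m => (bump m).contDiff.smul hU₀l
  have hdata_cpt : ∀ m, HasCompactSupport (data m) := fun m => (bump m).hasCompactSupport.smul_right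
  have hdata_eq : ∀ (m : ℕ) (y : EuclideanSpace ℝ (Fin n)), ‖y‖ ≤ (m : ℝ) + 1 →
      data m y = lift U₀ y := by
    intro m y hy
    show (bump m) y • lift U₀ y = lift U₀ y
    rw [(bump m).one_of_mem_closedBall (by simpa using hy), one_smul]
  -- the whole-space solutions
  choose V hV0 hVj _hVs hVeq using fun m : ℕ =>
    exists_smooth_solution hreg (hdata_smooth m) (hdata_cpt m)
  -- the propagation speeds
  choose c hc0 hc using fun T : ℕ => exists_speed_eq_of_data_eq hreg (T : ℝ)
  -- stabilisation: `V m = V m'` on `|t| ≤ T`, `‖y‖ < m + 1 - c_T |t|`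
  have hstab : ∀ (T m m' : ℕ), m ≤ m' → ∀ t : ℝ, |t| ≤ T → ∀ y : EuclideanSpace ℝ (Fin n),
      ‖y‖ < (m : ℝ) + 1 - c T * |t| → V m t y = V m' t y := by
    intro T m m' hmm' t ht y hy
    refine hc T (V m) (V m') (hVj m) (hVj m') (hVeq m) (hVeq m') 0 ((m : ℝ) + 1) ?_ t ht y
      (by simpa using hy)
    intro z hz
    rw [mem_closedBall, dist_zero_right] at hz
    rw [hV0, hV0, hdata_eq m z hz, hdata_eq m' z (hz.trans (by exact_mod_cast (by omega)))]
  -- periodicity across the family: `V m (t, y + k) = V m' (t, y)`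
  have hperV : ∀ (T m m' : ℕ), m ≤ m' → ∀ (k : Fin n → ℤ) (t : ℝ), |t| ≤ T →
      ∀ y : EuclideanSpace ℝ (Fin n), ‖y‖ < (m : ℝ) + 1 - ‖latticeVec k‖ - c T * |t| →
        V m t (y + latticeVec k) = V m' t y := by
    intro T m m' hmm' k t ht y hy
    have hshift : ContDiff ℝ ∞ fun p : ℝ × EuclideanSpace ℝ (Fin n) =>
        V m p.1 (p.2 + latticeVec k) :=
      (hVj m).comp (contDiff_fst.prodMk (contDiff_snd.add contDiff_const))
    refine hc T (fun s z => V m s (z + latticeVec k)) (V m') hshift (hVj m')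
      (hasDerivAt_foOp_translate (fun j s z => hAper j s z k) (fun s z => hBper s z k) (hVeq m))
      (hVeq m') 0 ((m : ℝ) + 1 - ‖latticeVec k‖) ?_ t ht y (by simpa using hy)
    intro z hz
    rw [mem_closedBall, dist_zero_right] at hz
    show V m 0 (z + latticeVec k) = V m' 0 z
    rw [hV0, hV0, hdata_eq m' z (by linarith [norm_nonneg (latticeVec k),
      (by exact_mod_cast hmm' : (m : ℝ) ≤ m')]), hdata_eq m (z + latticeVec k)
      ((norm_add_le _ _).trans (by linarith))]
    simp only [lift_apply, proj_add_latticeVec]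
  -- the limit field
  let U : ℝ → EuclideanSpace ℝ (Fin n) → W := fun t y => limUnder atTop fun m => V m t y
  have hU_eq : ∀ (T m : ℕ) (t : ℝ), |t| ≤ T → ∀ y : EuclideanSpace ℝ (Fin n),
      ‖y‖ + c T * |t| < (m : ℝ) + 1 → U t y = V m t y := by
    intro T m t ht y hy
    have hev : (fun _ : ℕ => V m t y) =ᶠ[atTop] fun m' => V m' t y :=
      Filter.eventually_atTop.2 ⟨m, fun m' hm' => hstab T m m' hm' t ht y (by linarith)⟩
    exact (tendsto_const_nhds.congr' hev).limUnder_eq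
  -- local representation: near every point `U` is one of the `V m`
  have hU_loc : ∀ (t₀ : ℝ) (y₀ : EuclideanSpace ℝ (Fin n)), ∃ m : ℕ,
      ∀ᶠ p in 𝓝 ((t₀, y₀) : ℝ × EuclideanSpace ℝ (Fin n)), U p.1 p.2 = V m p.1 p.2 := by
    intro t₀ y₀
    set T : ℕ := ⌈|t₀|⌉₊ + 1 with hT_def
    set m : ℕ := ⌈‖y₀‖ + 1 + c T * T⌉₊ with hm_def
    refine ⟨m, ?_⟩
    have hopen : IsOpen {p : ℝ × EuclideanSpace ℝ (Fin n) | |p.1| < T ∧ ‖p.2‖ < ‖y₀‖ + 1} :=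
      (isOpen_lt (continuous_abs.comp continuous_fst) continuous_const).inter
        (isOpen_lt (continuous_norm.comp continuous_snd) continuous_const)
    have hmem : ((t₀, y₀) : ℝ × EuclideanSpace ℝ (Fin n)) ∈
        {p : ℝ × EuclideanSpace ℝ (Fin n) | |p.1| < T ∧ ‖p.2‖ < ‖y₀‖ + 1} := by
      refine ⟨?_, by simp⟩
      show |t₀| < ((⌈|t₀|⌉₊ + 1 : ℕ) : ℝ)
      push_cast
      linarith [Nat.le_ceil |t₀|]
    filter_upwards [hopen.mem_nhds hmem] with p hp
    obtain ⟨hp1, hp2⟩ := hp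
    refine hU_eq T m p.1 hp1.le p.2 ?_
    have hcT : c T * |p.1| ≤ c T * T := mul_le_mul_of_nonneg_left hp1.le (hc0 T)
    have hm : ‖y₀‖ + 1 + c T * T ≤ (m : ℝ) := Nat.le_ceil _
    linarith
  -- joint smoothness
  have hUj : ContDiff ℝ ∞ fun p : ℝ × EuclideanSpace ℝ (Fin n) => U p.1 p.2 := by
    refine contDiff_iff_contDiffAt.2 fun p => ?_
    obtain ⟨m, hm⟩ := hU_loc p.1 p.2
    exact ((hVj m).contDiffAt).congr_of_eventuallyEq hm
  -- lattice periodicity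
  have hUper : ∀ (t : ℝ) (y : EuclideanSpace ℝ (Fin n)) (k : Fin n → ℤ),
      U t (y + latticeVec k) = U t y := by
    intro t y k
    set T : ℕ := ⌈|t|⌉₊ with hT_def
    have ht : |t| ≤ T := Nat.le_ceil _
    set m : ℕ := ⌈‖y‖ + ‖latticeVec k‖ + c T * |t|⌉₊ + 1 with hm_def
    have hm : ‖y‖ + ‖latticeVec k‖ + c T * |t| ≤ ((⌈‖y‖ + ‖latticeVec k‖ + c T * |t|⌉₊ : ℕ) : ℝ) :=
      Nat.le_ceil _
    have hm' : (m : ℝ) = ((⌈‖y‖ + ‖latticeVec k‖ + c T * |t|⌉₊ : ℕ) : ℝ) + 1 := by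
      simp [hm_def]
    have h1 : U t (y + latticeVec k) = V m t (y + latticeVec k) := by
      refine hU_eq T m t ht _ ?_
      linarith [norm_add_le y (latticeVec k), norm_nonneg (latticeVec k)]
    have h2 : U t y = V m t y := by
      refine hU_eq T m t ht _ ?_
      linarith [norm_nonneg (latticeVec k)]
    rw [h1, h2]
    exact hperV T m m le_rfl k t ht y (by linarith)
  -- the equation for `U`
  have hUeq : ∀ (t : ℝ) (y : EuclideanSpace ℝ (Fin n)),
      HasDerivAt (fun s => U s y) (foOp (fun j => Al j t) (Bl t) (U t) y) t := by
    intro t y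
    obtain ⟨m, hm⟩ := hU_loc t y
    -- along the time line and along the space slice
    have hline : (fun s => U s y) =ᶠ[𝓝 t] fun s => V m s y := by
      have hcont : Continuous fun s : ℝ => ((s, y) : ℝ × EuclideanSpace ℝ (Fin n)) :=
        continuous_id.prodMk continuous_const
      exact hcont.continuousAt.eventually hm
    have hslice : U t =ᶠ[𝓝 y] V m t := by
      have hcont : Continuous fun z : EuclideanSpace ℝ (Fin n) => ((t, z) : ℝ × EuclideanSpace ℝ (Fin n)) :=
        continuous_const.prodMk continuous_id
      exact hcont.continuousAt.eventually hm
    have hfo : foOp (fun j => Al j t) (Bl t) (U t) y = foOp (fun j => Al j t) (Bl t) (V m t) y := by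
      simp only [foOp_apply, hslice.fderiv_eq, hslice.self_of_nhds]
    rw [hfo]
    exact (hVeq m t y).congr_of_eventuallyEq hline
  -- descend to the torus
  have hUlat : ∀ t, IsLatticePeriodic (U t) := fun t j y => by
    rw [← latticeVec_single]
    exact hUper t y _
  let u : ℝ → UnitAddTorus (Fin n) → W := fun t => descend (U t) (hUlat t)
  have hlift : ∀ t, lift (u t) = U t := fun t => lift_descend_holds (U t) (hUlat t)
  have hu_apply : ∀ t x, u t x = U t (repr x) := fun t x => rfl
  refine ⟨u, ?_, ?_, ?_⟩
  · -- joint smoothness on the torus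
    show ContDiffOn ℝ ∞ (stLift u) (univ ×ˢ univ)
    rw [univ_prod_univ, contDiffOn_univ]
    have hst : stLift u = fun p : ℝ × EuclideanSpace ℝ (Fin n) => U p.1 p.2 := by
      funext p
      rw [stLift_apply, ← lift_apply (u p.1) p.2, hlift]
    rw [hst]
    exact hUj
  · -- the data
    funext x
    rw [hu_apply]
    set m : ℕ := ⌈‖repr x‖⌉₊ with hm_def
    have h1 : U 0 (repr x) = V m 0 (repr x) := by
      refine hU_eq 0 m 0 (by simp) (repr x) ?_
      simp only [abs_zero, mul_zero, add_zero]
      linarith [Nat.le_ceil ‖repr x‖]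
    rw [h1, hV0, hdata_eq m (repr x) (by linarith [Nat.le_ceil ‖repr x‖]), lift_apply, proj_repr]
  · -- the equation on the torus
    intro t x
    have hd := hUeq t (repr x)
    have h1 : timeDeriv u t x = foOp (fun j => Al j t) (Bl t) (U t) (repr x) := hd.deriv
    rw [h1, foOp_apply]
    have hsmooth : IsSmooth (u t) := by
      show ContDiff ℝ ∞ (lift (u t))
      rw [hlift]
      exact hUj.comp (contDiff_prodMk_right t)
    have hx : Torus.fderiv (u t) x = fderiv ℝ (U t) (repr x) := by
      rw [← hlift t, fderiv_lift, proj_repr]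
    congr 1
    · refine Finset.sum_congr rfl fun j _ => ?_
      rw [partialDeriv_eq_fderiv_apply (hsmooth.isContDiff (by simp)) j, ← bv_eq_single, hx]
      simp only [hAl_def, lift_apply, proj_repr]
    · rw [hu_apply]
      simp only [hBl_def, lift_apply, proj_repr]

end Transfer

end Literature.Analysis.PDE

end
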